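import Literature.Computability.Complexity.SpaceLoop
import Literature.Computability.Complexity.CookReducibilityTransitive
import HarnessLib

/-!
# `P^A ⊆ PSPACE` when the queries to `A` are answered by a space-bounded `FP` iteration

Proof toolkit for the named fact `PRel_subset_PSPACE_of_mem_PSPACE` (`SpaceOracles.lean`:
`P^A ⊆ PSPACE` for `A ∈ PSPACE`; Hirahara–Lu–Ren 2023, Rem. 2: "PSPACE^PSPACE = PSPACE";
Homer–Selman 2011, proof of Prop. 7.5 / Thm. 7.18), in the tree's models: `PRel` is the
transcript model of `Oracle.lean` (a polynomial-time step function `(x, answers) ↦ query | output`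
run for polynomially many rounds), and `PSPACE` membership is obtained through the loop machine of
`SpaceLoop.lean` (`SpaceLoop.mem_PSPACE_of_bound_until_flag`: iterate one `FP` function in place).
The printed proof — "each query is answered by running the space-bounded decider of `A` in the
same space" — is carried out against an ABSTRACT interface to that decider:

* `FPStepper A` — an **`FP` stepper** for the language `A`: polynomial-time string maps `initFn`
  (code of the initial configuration on the query `y`), `stepFn` (one step on codes), `haltFn`
  (the bit "halted?") and `ansFn` (the answer bit, correct once halted), such that the iteration
  `stepFn^[j] (initFn y)` stays of length `≤ bound |y|` for a polynomial `bound` and halts.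
  (`SpaceMachineStepper.lean` builds one for every `A ∈ PSPACE` from the universal step function
  of `CfgCodesFP.lean`; this file does not depend on machines.)
* `Stepper.G` — the small-step simulation of an oracle algorithm `M` on `x`: states
  `⟨t1, phase⟩` with `t1` the answer bits received so far and `phase ∈ {outer, inner w, done b}`;
  an outer step runs `M.step x (bitsTrans t1)` (output `b` ↦ `done b`; query `y` ↦
  `inner (initFn y)`), an inner step advances the stepper or, once halted, appends its answer bit
  and returns to `outer`.
* `Stepper.F` — its realisation as ONE `FP` string function on the tagged orbit words of the loop
  machine (`F (0x)` starts, `F (1 o)` continues from the previous orbit word `o = 0 ⟨⟨x, t1⟩, tag⟩`,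
  and a finished simulation is reported as the flagged word `1 b`), assembled from the tree's
  string toolkit (`iteFn`, `pairFn`, `fstP`/`sndP`, `PRelSigma.lastFn`, `concatFn`, …);
  `F_mem_FP`, `F_false`, `F_true`.
* `Stepper.mem_PSPACE` — **if `A` has an `FP` stepper then `PRel (Oracle.ofLanguage A) ⊆ PSPACE`**:
  along the genuine run of `M` (extracted from the `PRel` clauses by
  `PRelSigma.run_eq_some_iff`, as in `CookReducibilityTransitive.lean`) the orbit words have
  length `≤ 4|x| + 2q|x| + bound (q|x|) + O(1)` (answer bits `≤ q|x|`, queries of length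
  `≤ q|x|`) until the flag is raised with the answer `[x ∈ L]`.

## References

* S. Hirahara, Z. Lu, H. Ren, *Bounded relativization*, CCC 2023, LIPIcs 264, Rem. 2 (p. 3).
  [HiraharaLuRen2023]
* S. Homer, A. L. Selman, *Computability and Complexity Theory*, 2nd ed., Springer 2011, proof of
  Prop. 7.5 (`NP^PSPACE = PSPACE`) and Thm. 7.18. [HomerSelman2011]
* S. Arora, B. Barak, *Computational Complexity: A Modern Approach*, CUP 2009, §3.4 (oracle
  machines), §4.1 (reuse of space), §1.3 (machine constructions). [AroraBarak2009]
-/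

noncomputable section

namespace Literature.Computability.Complexity

open _root_.Computability Polynomial PRelSigma OracleCompose

/-! ### `FP` steppers -/

/-- **An `FP` stepper for the language `A`**: the decider of `A` presented as an iteration of
polynomial-time string maps — `initFn y` codes the initial configuration on the query `y`,
`stepFn` is one step on codes, `haltFn` reads the bit "halted?", `ansFn` reads the answer bit
(equal to `[y ∈ A]` once halted) — whose codes stay of polynomial length (`bound`) and which
halts on every query. This is what "running the space-bounded decider of `A` in place, one step
at a time" requires of `A`. [cite: HomerSelman2011, proof of Prop. 7.5 and Thm. 7.18] -/
structure FPStepper (A : Language Bool) where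
  /-- code of the initial configuration on a query -/
  initFn : List Bool → List Bool
  /-- one step on codes -/
  stepFn : List Bool → List Bool
  /-- the bit "halted?" of a code -/
  haltFn : List Bool → List Bool
  /-- the answer bit of a code -/
  ansFn : List Bool → List Bool
  /-- `initFn ∈ FP` -/
  initFn_mem : initFn ∈ FP
  /-- `stepFn ∈ FP` -/
  stepFn_mem : stepFn ∈ FP
  /-- `haltFn ∈ FP` -/
  haltFn_mem : haltFn ∈ FP
  /-- `ansFn ∈ FP` -/
  ansFn_mem : ansFn ∈ FP
  /-- the polynomial space bound -/
  bound : Polynomial ℕ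
  /-- the codes along the iteration have length `≤ bound |y|` -/
  length_le : ∀ (y : List Bool) (j : ℕ), (stepFn^[j] (initFn y)).length ≤ bound.eval y.length
  /-- `haltFn` is a bit along the iteration -/
  haltFn_bit : ∀ (y : List Bool) (j : ℕ), ∃ b : Bool, haltFn (stepFn^[j] (initFn y)) = [b]
  /-- the iteration halts -/
  halts : ∀ y : List Bool, ∃ N : ℕ, haltFn (stepFn^[N] (initFn y)) = [true]
  /-- once halted, the answer bit is `[y ∈ A]` -/
  ansFn_eq : ∀ (y : List Bool) (j : ℕ), haltFn (stepFn^[j] (initFn y)) = [true] →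
    ansFn (stepFn^[j] (initFn y)) = [A.boolIndicator y]

namespace Stepper

variable {A : Language Bool}

section Sim

variable (S : FPStepper A) (M : OracleAlg Bool) (x : List Bool)

/-! ### The small-step simulation (mathematical level) -/

/-- Phases of the simulation: about to run the outer step, inside an inner run (with the current
code), or finished with the output bit. [folklore] -/
inductive Ph
  | outer
  | inner (w : List Bool)
  | done (b : Bool)

/-- States of the simulation: the answer bits received by the outer algorithm so far, and the
phase. [folklore] -/
structure DState where
  /-- answer bits received so far -/
  t1 : List Bool
  /-- phase -/
  ph : Ph

/-- **One small step.** Outer: run the step function of `M` on the answers so far — an output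
finishes, a query starts an inner run on the code of the initial configuration. Inner: if halted,
append the answer bit and return to the outer phase, else advance the stepper. Done: stay.
[cite: HomerSelman2011, proof of Thm. 7.18 (each query answered by running the PSPACE decider)] -/
def G : DState → DState
  | ⟨t1, Ph.outer⟩ =>
    match M.step x (bitsTrans t1) with
    | Sum.inr b => ⟨t1, Ph.done b⟩
    | Sum.inl y => ⟨t1, Ph.inner (S.initFn y)⟩
  | ⟨t1, Ph.inner w⟩ =>
    if S.haltFn w = [true] then ⟨t1 ++ S.ansFn w, Ph.outer⟩ else ⟨t1, Ph.inner (S.stepFn w)⟩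
  | ⟨t1, Ph.done b⟩ => ⟨t1, Ph.done b⟩

/-- The initial state: no answers yet, outer phase. [folklore] -/
def s₀ : DState := ⟨[], Ph.outer⟩

/-- Outer step, output case. [folklore] -/
theorem G_outer_inr {t1 : List Bool} {b : Bool} (h : M.step x (bitsTrans t1) = Sum.inr b) :
    G S M x ⟨t1, Ph.outer⟩ = ⟨t1, Ph.done b⟩ := by
  simp [G, h]

/-- Outer step, query case. [folklore] -/
theorem G_outer_inl {t1 y : List Bool} (h : M.step x (bitsTrans t1) = Sum.inl y) :
    G S M x ⟨t1, Ph.outer⟩ = ⟨t1, Ph.inner (S.initFn y)⟩ := by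
  simp [G, h]

/-- Inner step, halted case. [folklore] -/
theorem G_inner_halt {t1 w : List Bool} (h : S.haltFn w = [true]) :
    G S M x ⟨t1, Ph.inner w⟩ = ⟨t1 ++ S.ansFn w, Ph.outer⟩ := by
  simp [G, h]

/-- Inner step, running case. [folklore] -/
theorem G_inner_run {t1 w : List Bool} (h : S.haltFn w ≠ [true]) :
    G S M x ⟨t1, Ph.inner w⟩ = ⟨t1, Ph.inner (S.stepFn w)⟩ := by
  simp [G, h]

/-- Done is fixed. [folklore] -/
@[simp] theorem G_done (t1 : List Bool) (b : Bool) : G S M x ⟨t1, Ph.done b⟩ = ⟨t1, Ph.done b⟩ := rfl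

/-- Done is fixed by all iterates. [folklore] -/
theorem iterate_G_done (t1 : List Bool) (b : Bool) (n : ℕ) :
    (G S M x)^[n] ⟨t1, Ph.done b⟩ = ⟨t1, Ph.done b⟩ := by
  induction n with
  | zero => rfl
  | succ n ih => rw [Function.iterate_succ_apply, G_done, ih]

/-- **An inner run**: from the code of the initial configuration on `y`, the simulation advances
the stepper until it first halts (`N` steps) and then returns to the outer phase with the answer
bit appended. [cite: HomerSelman2011, proof of Thm. 7.18] -/
theorem iterate_G_inner (t1 y : List Bool) {N : ℕ} (hN : S.haltFn (S.stepFn^[N] (S.initFn y)) = [true])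
    (hlt : ∀ j < N, S.haltFn (S.stepFn^[j] (S.initFn y)) ≠ [true]) :
    (∀ j ≤ N, (G S M x)^[j] ⟨t1, Ph.inner (S.initFn y)⟩ = ⟨t1, Ph.inner (S.stepFn^[j] (S.initFn y))⟩) ∧
      (G S M x)^[N + 1] ⟨t1, Ph.inner (S.initFn y)⟩ = ⟨t1 ++ [A.boolIndicator y], Ph.outer⟩ := by
  have hrun : ∀ j ≤ N, (G S M x)^[j] ⟨t1, Ph.inner (S.initFn y)⟩ = ⟨t1, Ph.inner (S.stepFn^[j] (S.initFn y))⟩ := by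
    intro j
    induction j with
    | zero => intro; rfl
    | succ j ih =>
      intro hj
      rw [Function.iterate_succ_apply', ih (by omega), G_inner_run S M x (hlt j (by omega)),
        Function.iterate_succ_apply']
  refine ⟨hrun, ?_⟩
  rw [Function.iterate_succ_apply', hrun N le_rfl, G_inner_halt S M x hN, S.ansFn_eq y N hN]

end Sim

/-! ### Along the genuine run -/

section Run

variable {S : FPStepper A} {M : OracleAlg Bool} {x : List Bool}

/-- The `i`-th query of the genuine run of `M` with the oracle of `A` on `x`. [folklore] -/
def qry (M : OracleAlg Bool) (A : Language Bool) (x : List Bool) (i : ℕ) : List Bool :=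
  qryOf M x (PRelSigma.trans M (Oracle.ofLanguage A) x i)

/-- **The data of the genuine run**: `m` query rounds with queries `qry i`, then the output `b`.
[folklore] -/
structure RunFacts (M : OracleAlg Bool) (A : Language Bool) (x : List Bool) (m : ℕ) (b : Bool) : Prop where
  /-- the first `m` steps are queries -/
  query : ∀ i < m, M.step x (bitsTrans (answerBits M A x i)) = Sum.inl (qry M A x i)
  /-- step `m` outputs `b` -/
  output : M.step x (bitsTrans (answerBits M A x m)) = Sum.inr b

/-- Run facts from the `PRel` output clause. [folklore] -/
theorem exists_runFacts {n : ℕ} {b : Bool} (h : M.run (Oracle.ofLanguage A) n x = some b) :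
    ∃ m, m < n ∧ RunFacts M A x m b := by
  obtain ⟨m, hm, hq, hout⟩ := (run_eq_some_iff M _ n x b).1 h
  refine ⟨m, hm, fun i hi => ?_, by rwa [← trans_eq_bitsTrans_answerBits]⟩
  obtain ⟨y, hy⟩ := hq i hi
  rw [← trans_eq_bitsTrans_answerBits, hy, qry, qryOf_eq_of_step_eq hy]

/-- The queries of the genuine run are among the recorded queries, hence short under the `PRel`
query clause. [folklore] -/
theorem qry_mem_queries {n m : ℕ} {b : Bool} (hm : m < n) (D : RunFacts M A x m b) {i : ℕ} (hi : i < m) :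
    qry M A x i ∈ M.queries (Oracle.ofLanguage A) n x :=
  mem_queries_of_trans M _ n x i (by omega) fun i' hi' =>
    ⟨qry M A x i', by rw [trans_eq_bitsTrans_answerBits]; exact D.query i' (by omega)⟩

/-- **Good states** (the invariant of the simulation along the genuine run with `m` queries and
output `b`): the answer bits are the genuine answer bits of some round `i ≤ m`; an inner phase
carries an iterate of the stepper started on the genuine query of round `i < m`; a done phase
carries `b`. [folklore] -/
def Good (S : FPStepper A) (M : OracleAlg Bool) (x : List Bool) (m : ℕ) (b : Bool) (s : DState) : Prop :=
  ∃ i ≤ m, s.t1 = answerBits M A x i ∧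
    match s.ph with
    | Ph.outer => True
    | Ph.inner w => i < m ∧ ∃ j, w = S.stepFn^[j] (S.initFn (qry M A x i))
    | Ph.done b' => b' = b

/-- The initial state is good. [folklore] -/
theorem good_s₀ (m : ℕ) (b : Bool) : Good S M x m b s₀ :=
  ⟨0, Nat.zero_le _, by simp [s₀, answerBits], trivial⟩

/-- **`G` preserves goodness.** [cite: HomerSelman2011, proof of Thm. 7.18] -/
theorem Good.step {m : ℕ} {b : Bool} (D : RunFacts M A x m b) {s : DState} (hs : Good S M x m b s) :
    Good S M x m b (G S M x s) := by
  obtain ⟨t1, ph⟩ := s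
  obtain ⟨i, hi, ht1, hph⟩ := hs
  simp only at ht1 hph
  subst ht1
  cases ph with
  | outer =>
    rcases Nat.lt_or_ge i m with h | h
    · rw [G_outer_inl S M x (D.query i h)]
      exact ⟨i, hi, rfl, h, 0, rfl⟩
    · obtain rfl : m = i := (le_antisymm hi h).symm
      rw [G_outer_inr S M x D.output]
      exact ⟨m, le_rfl, rfl, rfl⟩
  | inner w =>
    obtain ⟨him, j, rfl⟩ := hph
    by_cases hh : S.haltFn (S.stepFn^[j] (S.initFn (qry M A x i))) = [true]
    · rw [G_inner_halt S M x hh, S.ansFn_eq _ j hh]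
      refine ⟨i + 1, him, ?_, trivial⟩
      simp only [answerBits_succ, qry]
    · rw [G_inner_run S M x hh]
      exact ⟨i, hi, rfl, him, j + 1, by rw [Function.iterate_succ_apply']⟩
  | done b' =>
    rw [G_done]
    exact ⟨i, hi, rfl, hph⟩

/-- All states of the trajectory are good. [folklore] -/
theorem good_iterate {m : ℕ} {b : Bool} (D : RunFacts M A x m b) (n : ℕ) :
    Good S M x m b ((G S M x)^[n] s₀) := by
  induction n with
  | zero => exact good_s₀ m b
  | succ n ih => rw [Function.iterate_succ_apply']; exact ih.step D

/-- **The outer loop**: the simulation reaches `⟨answerBits i, outer⟩` for every `i ≤ m`.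
[cite: HomerSelman2011, proof of Thm. 7.18] -/
theorem exists_iterate_outer {m : ℕ} {b : Bool} (D : RunFacts M A x m b) :
    ∀ i ≤ m, ∃ n, (G S M x)^[n] s₀ = ⟨answerBits M A x i, Ph.outer⟩
  | 0, _ => ⟨0, by simp [s₀, answerBits]⟩
  | i + 1, hi => by
    obtain ⟨n, hn⟩ := exists_iterate_outer D i (by omega)
    classical
    let N := Nat.find (S.halts (qry M A x i))
    have hN : S.haltFn (S.stepFn^[N] (S.initFn (qry M A x i))) = [true] := Nat.find_spec (S.halts (qry M A x i))
    have hlt : ∀ j < N, S.haltFn (S.stepFn^[j] (S.initFn (qry M A x i))) ≠ [true] := fun j hj =>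
      Nat.find_min (S.halts (qry M A x i)) hj
    refine ⟨(N + 1) + 1 + n, ?_⟩
    rw [Function.iterate_add_apply, hn, Function.iterate_add_apply, Function.iterate_one,
      G_outer_inl S M x (D.query i (by omega)), (iterate_G_inner S M x _ _ hN hlt).2, answerBits_succ]
    rfl

/-- **The simulation finishes** with the output of the genuine run. [cite: HomerSelman2011, proof of Thm. 7.18] -/
theorem exists_iterate_done {m : ℕ} {b : Bool} (D : RunFacts M A x m b) :
    ∃ n, (G S M x)^[n + 1] s₀ = ⟨answerBits M A x m, Ph.done b⟩ := by
  obtain ⟨n, hn⟩ := exists_iterate_outer (S := S) D m le_rfl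
  exact ⟨n, by rw [Function.iterate_succ_apply', hn, G_outer_inr S M x D.output]⟩

end Run

/-! ### String level: states and orbit words -/

section Str

variable (S : FPStepper A) (M : OracleAlg Bool) (x : List Bool)

/-- The tag of a phase: `00` outer, `1 w` inner, `01b` done. [folklore] -/
def tag : Ph → List Bool
  | Ph.outer => [false, false]
  | Ph.inner w => true :: w
  | Ph.done b => [false, true, b]

/-- The string of a state: `⟨⟨x, t1⟩, tag⟩`. [folklore] -/
def encSt (s : DState) : List Bool := boolPair (boolPair x s.t1) (tag s.ph)

/-- The orbit word of a state: the flagged word `1 b` when done, else `0` and the state string.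
[folklore] -/
def outW (s : DState) : List Bool :=
  match s.ph with
  | Ph.done b => [true, b]
  | _ => false :: encSt x s

/-- "The first symbol is `b`", as a one-bit string function. [folklore] -/
def isT (b : Bool) : List Bool → List Bool := (headT b).eval

/-- `isT b w = [w.head? = some b]`. [folklore] -/
@[simp] theorem isT_apply (b : Bool) (w : List Bool) : isT b w = [decide (w.head? = some b)] := headT_eval b w

/-- `isT b ∈ FP`. [folklore] -/
theorem isT_mem_FP (b : Bool) : isT b ∈ FP := (headT b).polyTimeComputable_eval

/-- The current inner code, read off a state string: `tail (snd z)`. [folklore] -/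
def cwFn : List Bool → List Bool := List.tail ∘ sndP

/-- `cwFn ∈ FP`. [folklore] -/
theorem cwFn_mem_FP : cwFn ∈ FP := comp_mem_FP tail_mem_FP sndP_mem_FP

/-- Exit of an inner run: append the answer bit, tag `outer`. [folklore] -/
def exitBr : List Bool → List Bool :=
  pairFn (pairFn xFn (concatFn ∘ pairFn asFn (S.ansFn ∘ cwFn))) fun _ => [false, false]

/-- Continue an inner run: one stepper step. [folklore] -/
def contBr : List Bool → List Bool := pairFn fstP (List.cons true ∘ S.stepFn ∘ cwFn)

/-- The inner branch. [folklore] -/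
def innerBr : List Bool → List Bool := iteFn (S.haltFn ∘ cwFn) (exitBr S) (contBr S)

/-- The outer branch: run the step of `M`; an output `b` becomes the tag `01b`, a query `y` the
tag `1 (initFn y)`. [folklore] -/
def outerBr : List Bool → List Bool :=
  iteFn (isT true ∘ lastFn M) (pairFn fstP (List.cons false ∘ List.cons true ∘ List.tail ∘ lastFn M))
    (pairFn fstP (List.cons true ∘ S.initFn ∘ List.tail ∘ lastFn M))

/-- **The string small step**: dispatch on the tag. [cite: AroraBarak2009, §1.3 (finite control)] -/
def GFn : List Bool → List Bool :=
  iteFn (isT true ∘ sndP) (innerBr S) (iteFn (isT true ∘ List.tail ∘ sndP) id (outerBr S M))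

/-- The orbit word of a state string. [folklore] -/
def owordFn : List Bool → List Bool :=
  iteFn (isT false ∘ sndP)
    (iteFn (isT true ∘ List.tail ∘ sndP) (List.cons true ∘ List.tail ∘ List.tail ∘ sndP) (List.cons false))
    (List.cons false)

/-- The initial state string of an input. [folklore] -/
def initS : List Bool → List Bool := pairFn (pairFn id fun _ => []) fun _ => [false, false]

/-- **The orbit function** handed to the loop machine: on `0x` start, on `1 (0 s)` continue from
the state string `s`. [cite: AroraBarak2009, §4.1 (reuse of space: one round at a time)] -/
def F : List Bool → List Bool :=
  iteFn (isT true) (owordFn ∘ GFn S M ∘ List.tail ∘ List.tail) (owordFn ∘ GFn S M ∘ initS ∘ List.tail)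

/-! ### Polynomial time -/

/-- `exitBr ∈ FP`. [folklore] -/
theorem exitBr_mem_FP : exitBr S ∈ FP :=
  pairFn_mem_FP (pairFn_mem_FP xFn_mem_FP (comp_mem_FP concatFn_mem_FP
    (pairFn_mem_FP asFn_mem_FP (comp_mem_FP S.ansFn_mem cwFn_mem_FP)))) (const_mem_FP _)

/-- `contBr ∈ FP`. [folklore] -/
theorem contBr_mem_FP : contBr S ∈ FP :=
  pairFn_mem_FP fstP_mem_FP (comp_mem_FP (cons_mem_FP true) (comp_mem_FP S.stepFn_mem cwFn_mem_FP))

/-- `innerBr ∈ FP`. [folklore] -/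
theorem innerBr_mem_FP : innerBr S ∈ FP :=
  iteFn_mem_FP (comp_mem_FP S.haltFn_mem cwFn_mem_FP) (exitBr_mem_FP S) (contBr_mem_FP S)

/-- `outerBr ∈ FP` for polynomial-time `M`. [folklore] -/
theorem outerBr_mem_FP (hM : M.IsPolyTime encodingBoolBool) : outerBr S M ∈ FP :=
  iteFn_mem_FP (comp_mem_FP (isT_mem_FP true) (lastFn_mem_FP M hM))
    (pairFn_mem_FP fstP_mem_FP (comp_mem_FP (cons_mem_FP false) (comp_mem_FP (cons_mem_FP true)
      (comp_mem_FP tail_mem_FP (lastFn_mem_FP M hM)))))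
    (pairFn_mem_FP fstP_mem_FP (comp_mem_FP (cons_mem_FP true) (comp_mem_FP S.initFn_mem
      (comp_mem_FP tail_mem_FP (lastFn_mem_FP M hM)))))

/-- `GFn ∈ FP` for polynomial-time `M`. [folklore] -/
theorem GFn_mem_FP (hM : M.IsPolyTime encodingBoolBool) : GFn S M ∈ FP :=
  iteFn_mem_FP (comp_mem_FP (isT_mem_FP true) sndP_mem_FP) (innerBr_mem_FP S)
    (iteFn_mem_FP (comp_mem_FP (isT_mem_FP true) (comp_mem_FP tail_mem_FP sndP_mem_FP)) id_mem_FP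
      (outerBr_mem_FP S M hM))

/-- `owordFn ∈ FP`. [folklore] -/
theorem owordFn_mem_FP : owordFn ∈ FP :=
  iteFn_mem_FP (comp_mem_FP (isT_mem_FP false) sndP_mem_FP)
    (iteFn_mem_FP (comp_mem_FP (isT_mem_FP true) (comp_mem_FP tail_mem_FP sndP_mem_FP))
      (comp_mem_FP (cons_mem_FP true) (comp_mem_FP tail_mem_FP (comp_mem_FP tail_mem_FP sndP_mem_FP)))
      (cons_mem_FP false))
    (cons_mem_FP false)

/-- `initS ∈ FP`. [folklore] -/
theorem initS_mem_FP : initS ∈ FP :=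
  pairFn_mem_FP (pairFn_mem_FP id_mem_FP (const_mem_FP _)) (const_mem_FP _)

/-- **`F ∈ FP`** for polynomial-time `M`. [cite: AroraBarak2009, §1.3] -/
theorem F_mem_FP (hM : M.IsPolyTime encodingBoolBool) : F S M ∈ FP :=
  iteFn_mem_FP (isT_mem_FP true)
    (comp_mem_FP owordFn_mem_FP (comp_mem_FP (GFn_mem_FP S M hM) (comp_mem_FP tail_mem_FP tail_mem_FP)))
    (comp_mem_FP owordFn_mem_FP (comp_mem_FP (GFn_mem_FP S M hM) (comp_mem_FP initS_mem_FP tail_mem_FP)))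

/-! ### Semantics of the string functions on state strings -/

/-- `cwFn` reads the inner code. [folklore] -/
@[simp] theorem cwFn_apply (t1 : List Bool) (c : Bool) (w : List Bool) :
    cwFn (boolPair (boolPair x t1) (c :: w)) = w := by
  simp [cwFn]

/-- **The string small step is the small step** (on states whose inner code, if any, has a
well-defined halting bit). [cite: HomerSelman2011, proof of Thm. 7.18] -/
theorem GFn_encSt (s : DState) (hs : ∀ w, s.ph = Ph.inner w → ∃ b : Bool, S.haltFn w = [b]) :
    GFn S M (encSt x s) = encSt x (G S M x s) := by
  obtain ⟨t1, ph⟩ := s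
  cases ph with
  | inner w =>
    obtain ⟨b, hb⟩ := hs w rfl
    rw [GFn, iteFn_apply_true (by simp [encSt, tag]), innerBr]
    cases b with
    | true =>
      rw [iteFn_apply_true (by simp [encSt, tag, hb]), G_inner_halt S M x hb, exitBr]
      simp [encSt, tag]
    | false =>
      rw [iteFn_apply_false (by simp [encSt, tag, hb]), G_inner_run S M x (by simp [hb]), contBr]
      simp [encSt, tag]
  | outer =>
    rw [GFn, iteFn_apply_false (by simp [encSt, tag]), iteFn_apply_false (by simp [encSt, tag]), outerBr]
    cases hst : M.step x (bitsTrans t1) with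
    | inl y =>
      rw [iteFn_apply_false (by simp [encSt, tag, lastFn_apply, hst]), G_outer_inl S M x hst]
      simp [encSt, tag, lastFn_apply, hst]
    | inr b =>
      rw [iteFn_apply_true (by simp [encSt, tag, lastFn_apply, hst]), G_outer_inr S M x hst]
      simp [encSt, tag, lastFn_apply, hst]
  | done b =>
    rw [GFn, iteFn_apply_false (by simp [encSt, tag]), iteFn_apply_true (by simp [encSt, tag]), G_done]
    rfl

/-- **The orbit word of a state string is the orbit word of the state.** [folklore] -/
theorem owordFn_encSt (s : DState) : owordFn (encSt x s) = outW x s := by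
  obtain ⟨t1, ph⟩ := s
  cases ph with
  | inner w => rw [owordFn, iteFn_apply_false (by simp [encSt, tag])]; rfl
  | outer => rw [owordFn, iteFn_apply_true (by simp [encSt, tag]), iteFn_apply_false (by simp [encSt, tag])]; rfl
  | done b =>
    rw [owordFn, iteFn_apply_true (by simp [encSt, tag]), iteFn_apply_true (by simp [encSt, tag])]
    simp [encSt, tag, outW]

/-- `initS x` is the string of the initial state. [folklore] -/
theorem initS_apply : initS x = encSt x s₀ := by
  simp [initS, encSt, s₀, tag]

/-- **`F` on the start word `0x`.** [folklore] -/
theorem F_false : F S M (false :: x) = outW x (G S M x s₀) := by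
  rw [F, iteFn_apply_false (by simp)]
  simp only [Function.comp_apply, List.tail_cons]
  rw [initS_apply, GFn_encSt S M x s₀ (fun w h => by cases h), owordFn_encSt]

/-- A state is finished. [folklore] -/
def IsDone (s : DState) : Prop := ∃ b, s.ph = Ph.done b

/-- The orbit word of an unfinished state is `0` and its string. [folklore] -/
theorem outW_of_not_isDone {s : DState} (h : ¬ IsDone s) : outW x s = false :: encSt x s := by
  obtain ⟨t1, ph⟩ := s
  cases ph with
  | done b => exact absurd ⟨b, rfl⟩ h
  | _ => rfl

/-- **`F` on a continuation word `1 (0 s)`.** [folklore] -/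
theorem F_true (s : DState) (hs : ∀ w, s.ph = Ph.inner w → ∃ b : Bool, S.haltFn w = [b])
    (hnd : ¬ IsDone s) : F S M (true :: outW x s) = outW x (G S M x s) := by
  rw [outW_of_not_isDone x hnd, F, iteFn_apply_true (by simp)]
  simp only [Function.comp_apply, List.tail_cons]
  rw [GFn_encSt S M x s hs, owordFn_encSt]

/-! ### The orbit of the loop machine -/

section Orbit

variable {S M x} {m : ℕ} {b : Bool}

/-- Good states have well-defined inner halting bits. [folklore] -/
theorem Good.haltFn_bit {s : DState} (hs : Good S M x m b s) :
    ∀ w, s.ph = Ph.inner w → ∃ b' : Bool, S.haltFn w = [b'] := by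
  intro w hw
  obtain ⟨i, -, -, hph⟩ := hs
  rw [hw] at hph
  obtain ⟨-, j, rfl⟩ := hph
  exact S.haltFn_bit _ j

/-- **The orbit follows the simulation**: as long as no earlier state is finished, the `k`-th
orbit word is the orbit word of the `(k+1)`-st state. [cite: AroraBarak2009, §4.1 (one round at a time, reusing space)] -/
theorem orbit_eq (D : RunFacts M A x m b) :
    ∀ k, (∀ j < k, ¬ IsDone ((G S M x)^[j + 1] s₀)) →
      SpaceLoop.orbit (F S M) x k = outW x ((G S M x)^[k + 1] s₀)
  | 0, _ => by rw [SpaceLoop.orbit_zero, F_false]; rfl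
  | k + 1, hk => by
    rw [SpaceLoop.orbit_succ, orbit_eq D k fun j hj => hk j (by omega),
      F_true S M x _ (good_iterate D (k + 1)).haltFn_bit (hk k (by omega)),
      ← Function.iterate_succ_apply' (G S M x)]

/-- Unflagged orbit words come from unfinished states. [folklore] -/
theorem not_isDone_of_unflagged (D : RunFacts M A x m b) :
    ∀ k, (∀ j < k, ∃ w', SpaceLoop.orbit (F S M) x j = false :: w') →
      ∀ j < k, ¬ IsDone ((G S M x)^[j + 1] s₀) := by
  intro k hk j
  induction j using Nat.strong_induction_on with
  | _ j ih =>
    intro hj hdone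
    have horb := orbit_eq (S := S) D j fun j' hj' => ih j' hj' (by omega)
    obtain ⟨w', hw'⟩ := hk j hj
    obtain ⟨b', hb'⟩ := hdone
    rw [hw'] at horb
    have : outW x ((G S M x)^[j + 1] s₀) = [true, b'] := by
      generalize hs : (G S M x)^[j + 1] s₀ = s at hb' ⊢
      obtain ⟨t1, ph⟩ := s
      simp only at hb'
      subst hb'
      rfl
    rw [this] at horb
    cases horb

/-- **Length of the orbit words along the genuine run**: `≤ 4|x| + 2q|x| + bound (q|x|) + 10`
(answer bits `≤ m < q|x|`, inner codes `≤ bound |y| ≤ bound (q|x|)` for the genuine queries `y`).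
[cite: HomerSelman2011, proof of Prop. 7.5 (polynomial space)] -/
theorem length_outW_le {q : Polynomial ℕ} (hm : m < q.eval x.length)
    (hq : ∀ i < m, (qry M A x i).length ≤ q.eval x.length) {s : DState} (hs : Good S M x m b s) :
    (outW x s).length ≤ 4 * x.length + 2 * q.eval x.length + S.bound.eval (q.eval x.length) + 10 := by
  obtain ⟨t1, ph⟩ := s
  obtain ⟨i, hi, ht1, hph⟩ := hs
  simp only at ht1 hph
  subst ht1
  have hlen : (answerBits M A x i).length ≤ q.eval x.length := by rw [length_answerBits]; omega
  cases ph with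
  | done b' => simp [outW]
  | outer =>
    simp only [outW, encSt, tag, List.length_cons, length_boolPair, List.length_nil]
    omega
  | inner w =>
    obtain ⟨him, j, rfl⟩ := hph
    have h1 := S.length_le (qry M A x i) j
    have h2 : S.bound.eval (qry M A x i).length ≤ S.bound.eval (q.eval x.length) :=
      TM2Iter.eval_mono S.bound (hq i him)
    simp only [outW, encSt, tag, List.length_cons, length_boolPair]
    omega

end Orbit

end Str

/-! ### `P^A ⊆ PSPACE` from a stepper -/

/-- **A language with an `FP` stepper supports polynomial-space oracle simulation**: if `A` has an
`FP` stepper then every `L ∈ P^A` is in `PSPACE` — the loop machine iterates `F` in place; along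
the genuine run the orbit words have polynomial length and the flag is raised with `[x ∈ L]`.
[cite: HiraharaLuRen2023, Rem. 2 (PSPACE^PSPACE = PSPACE)] [cite: HomerSelman2011, proof of Prop. 7.5 and Thm. 7.18] -/
theorem mem_PSPACE (S : FPStepper A) {L : Language Bool} (hL : L ∈ PRel (Oracle.ofLanguage A)) :
    L ∈ PSPACE := by
  classical
  obtain ⟨M, hM, q, hq⟩ := hL
  refine SpaceLoop.mem_PSPACE_of_bound_until_flag (F_mem_FP S M hM) (4 * X + 2 * q + S.bound.comp q + 10)
    (fun x k hk => ?_) (fun x => ?_)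
  · obtain ⟨m, hm, D⟩ := exists_runFacts (hq x).1
    have hqry : ∀ i < m, (qry M A x i).length ≤ q.eval x.length := fun i hi =>
      (hq x).2 _ (qry_mem_queries hm D hi)
    rw [orbit_eq (S := S) D k (not_isDone_of_unflagged D k hk)]
    refine (length_outW_le hm hqry (good_iterate D (k + 1))).trans (le_of_eq ?_)
    simp [Polynomial.eval_comp]
  · obtain ⟨m, hm, D⟩ := exists_runFacts (hq x).1
    have hex : ∃ n, IsDone ((G S M x)^[n + 1] s₀) := by
      obtain ⟨n, hn⟩ := exists_iterate_done (S := S) D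
      exact ⟨n, L.boolIndicator x, by rw [hn]⟩
    refine ⟨Nat.find hex, [], ?_, fun k hk => ?_⟩
    · have hmin : ∀ j < Nat.find hex, ¬ IsDone ((G S M x)^[j + 1] s₀) := fun j hj => Nat.find_min hex hj
      rw [orbit_eq (S := S) D _ hmin]
      obtain ⟨b', hb'⟩ := Nat.find_spec hex
      have hgood := good_iterate (S := S) D (Nat.find hex + 1)
      generalize hs : (G S M x)^[Nat.find hex + 1] s₀ = s at hb' hgood ⊢
      obtain ⟨t1, ph⟩ := s
      simp only at hb'
      subst hb'
      obtain ⟨i, -, -, hph⟩ := hgood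
      simp only at hph
      subst hph
      rfl
    · have hmin : ∀ j < k, ¬ IsDone ((G S M x)^[j + 1] s₀) := fun j hj =>
        Nat.find_min hex (lt_trans hj hk)
      rw [orbit_eq (S := S) D k hmin, outW_of_not_isDone x (Nat.find_min hex hk)]
      exact ⟨_, rfl⟩

/-- **`P^A ⊆ PSPACE` for every language `A` with an `FP` stepper.** [cite: HiraharaLuRen2023, Rem. 2] [cite: HomerSelman2011, Thm. 7.18 (proof)] -/
theorem PRel_subset_PSPACE (S : FPStepper A) : PRel (Oracle.ofLanguage A) ⊆ PSPACE :=
  fun _ hL => mem_PSPACE S hL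

end Stepper

end Literature.Computability.Complexity

end
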